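import Literature.Probability.RandomPlanarGeometry.SLEMarkovKernelReadOff
import Literature.Probability.RandomPlanarGeometry.CompactifiedClassMeasurable
import Literature.Probability.RandomPlanarGeometry.SLEKappaRhoFlow
import HarnessLib

/-!
# The domain-Markov kernel of chordal SLE_κ: measurability and transport of the read-off value

Topic `Probability/RandomPlanarGeometry`; theorems (companion of `SLEMarkovKernelReadOff.lean`,
crux `stmt-CriticalPhenomena-0698`, stub `stub_isDomainMarkov`).

* `measurable_gval` — the read-off kernel value `gval κ φ F S T` is Borel in the class
  (measurable parametrisation `psiTilde` of `SLEKernelFunctional`, parametrised compactified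
  classes of `CompactifiedClassMeasurable`, sections of a product-measurable graph for the
  future law `measurable_futureLawOf_apply`);
* `lintegral_indicator_sleMarkovKernel_eq` — transport of the kernel integral of a push-forward
  law carried by describable classes to the canonical space (`gval` a.e. equals the integrand);
* `Loewner.loewnerInv_eq_of_eqOn`, `psiTilde_eq_of_eqOn` — `f_r` and `psiTilde Φ W r` only depend
  on the driver up to time `r`; `compactifiedClass_congr₂`.

References: W. Werner (2007), §3.2; G. F. Lawler (2005), §4.1.
-/

noncomputable section

open Set Filter Topology MeasureTheory ProbabilityTheory Complex
open UpperHalfPlane (upperHalfPlaneSet isOpen_upperHalfPlaneSet)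
open scoped NNReal ENNReal unitInterval

namespace Literature.Probability.RandomPlanarGeometry

/-! ### Measurability of the read-off kernel value and transport of the kernel integral -/

section Transport

open scoped PathBorel

variable {κ : ℝ≥0} {D : DobrushinDomain} {φ : ConformalEquiv upperHalfPlaneSet D.carrier}
  (hφ : D.IsChordalUniformizing φ)

attribute [local irreducible] psiTilde

/-- `drivingPathClass` is Borel measurable (`measurable_drivingPathOf`). [folklore] -/
theorem measurable_drivingPathClass (hφ : D.IsChordalUniformizing φ) :
    Measurable (drivingPathClass φ) :=
  measurable_drivingPathOf hφ

/-- The parametrisation read off a class is measurable jointly in (class-datum, point). [folklore] -/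
theorem measurable_psiTilde_comp {𝒴 : Type*} [MeasurableSpace 𝒴] (hφ : D.IsChordalUniformizing φ)
    {cl : 𝒴 → CurveClass ℂ} (hcl : Measurable cl) {r : 𝒴 → ℝ≥0} (hr : Measurable r) :
    Measurable (Function.uncurry fun (y : 𝒴) (w : ℂ) ↦ psiTilde (Φp φ) (drivingPathClass φ (cl y)) (r y) w) := by
  have h : Measurable fun p : (C(ℝ≥0, ℝ) × ℝ≥0) × ℂ ↦ psiTilde (Φp φ) p.1.1 p.1.2 p.2 :=
    measurable_psiTilde (continuous_Φp φ).measurable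
  have hg : Measurable fun q : 𝒴 × ℂ ↦ ((drivingPathClass φ (cl q.1), r q.1), q.2) :=
    ((((measurable_drivingPathClass hφ).comp (hcl.comp measurable_fst)).prodMk
      (hr.comp measurable_fst)).prodMk measurable_snd)
  exact h.comp hg

include hφ in
/-- **The read-off future law of a measurable set is measurable in the class** (through the
product-measurable graph `{(c, ω') | future class ∈ T}` and the measurable trace functional).
[folklore] -/
theorem measurable_futureLawOf_apply (h0 : HasSLETrace κ) {r : CurveClass ℂ → ℝ≥0}
    (hr : Measurable r) {T : Set (CurveClass ℂ)} (hT : MeasurableSet T) :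
    Measurable fun c ↦ futureLawOf κ φ c (r c) T := by
  obtain ⟨Tr, hTrm, hTr⟩ := Loewner.exists_measurable_eq_trace
  -- the measurable graph
  have hΨ := measurable_psiTilde_comp (𝒴 := CurveClass ℂ × (ℝ≥0 → ℝ)) hφ
    (measurable_fst) (hr.comp measurable_fst)
  have hG : Measurable fun p : CurveClass ℂ × (ℝ≥0 → ℝ) ↦
      compactifiedClass (psiTilde (Φp φ) (drivingPathClass φ p.1) (r p.1)) (D.pt 1)
        (Tr (sleDriving κ p.2)) :=
    measurable_compactifiedClass₃ hΨ measurable_const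
      (hTrm.comp ((measurable_sleDriving_pi κ).comp measurable_snd))
  set E : Set (CurveClass ℂ × (ℝ≥0 → ℝ)) := (fun p ↦
      compactifiedClass (psiTilde (Φp φ) (drivingPathClass φ p.1) (r p.1)) (D.pt 1)
        (Tr (sleDriving κ p.2))) ⁻¹' T with hE
  have hEm : MeasurableSet E := hG hT
  have hsec : Measurable fun c ↦ Process.preWienerMeasure (Prod.mk c ⁻¹' E) :=
    measurable_measure_prodMk_left hEm
  suffices heq : (fun c ↦ futureLawOf κ φ c (r c) T) = fun c ↦ Process.preWienerMeasure (Prod.mk c ⁻¹' E) by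
    rw [heq]; exact hsec
  funext c
  -- identify the section measure with the image law at `T`
  have hψm : Measurable (psiTilde (Φp φ) (drivingPathClass φ c) (r c)) := by
    have h : Measurable fun p : (C(ℝ≥0, ℝ) × ℝ≥0) × ℂ ↦ psiTilde (Φp φ) p.1.1 p.1.2 p.2 :=
      measurable_psiTilde (continuous_Φp φ).measurable
    exact h.comp ((measurable_const (a := (drivingPathClass φ c, r c))).prodMk measurable_id)
  have hf : AEMeasurable (fun ω ↦ compactifiedClass (psiTilde (Φp φ) (drivingPathClass φ c) (r c))
      (D.pt 1) (sleTrace κ ω)) Process.preWienerMeasure :=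
    (measurable_compactifiedClass hψm _).comp_aemeasurable (aemeasurable_sleTrace_pi h0)
  unfold futureLawOf sleImageLaw
  rw [Measure.map_apply_of_aemeasurable hf hT]
  refine (measure_congr ?_).symm
  filter_upwards [h0] with ω hω
  have htr : Tr (sleDriving κ ω) = sleTrace κ ω := hTr _ (continuous_sleDriving κ ω) hω
  have key : (ω ∈ (fun ω ↦ compactifiedClass (psiTilde (Φp φ) (drivingPathClass φ c) (r c)) (D.pt 1)
      (sleTrace κ ω)) ⁻¹' T) ↔ (ω ∈ Prod.mk c ⁻¹' E) := by
    simp only [hE, mem_preimage, htr]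
  exact propext key.symm

include hφ in
/-- **The read-off kernel value is Borel in the class.** [folklore] -/
theorem measurable_gval (h0 : HasSLETrace κ) {F : Set ℂ} (hF : IsClosed F)
    {S T : Set (CurveClass ℂ)} (hS : MeasurableSet S) (hT : MeasurableSet T) :
    Measurable (gval κ φ F S T) := by
  classical
  have hA : IsClosed (Φp φ ⁻¹' F) := isClosed_preimage_Φp hF
  have hτ : Measurable (traceHitTime φ (Φp φ ⁻¹' F)) := measurable_traceHitTime hφ hA
  have hr : Measurable fun c ↦ (traceHitTime φ (Φp φ ⁻¹' F) c).untopD 0 := hτ.untopD _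
  have htrc := measurable_uncurry_trace_drivingFunction hφ
  have hone : Measurable (S.indicator fun _ : CurveClass ℂ ↦ (1 : ℝ≥0∞)) :=
    measurable_const.indicator hS
  -- the read-off stopped class is measurable in `c`
  have hpast : Measurable fun c ↦ pastClassOf φ c ((traceHitTime φ (Φp φ ⁻¹' F) c).untopD 0) := by
    unfold pastClassOf
    refine measurable_compactifiedClass₃ (Ψ := fun _ ↦ Φp φ) ?_ ?_ ?_
    · exact (continuous_Φp φ).measurable.comp measurable_snd
    · exact (continuous_Φp φ).measurable.comp (htrc.comp (measurable_id.prodMk hr))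
    · exact measurable_pi_lambda _ fun t ↦ htrc.comp (measurable_id.prodMk (hr.mul_const _))
  have hfut := measurable_futureLawOf_apply hφ h0 hr hT
  unfold gval
  refine Measurable.ite (hτ (measurableSet_singleton ⊤)) ?_ ?_
  · exact hone.mul measurable_const
  · exact (hone.comp hpast).mul hfut


/-! #### Transport of the kernel integral under a law carried by describable classes -/

include hφ in
/-- **Under a curve law carried by describable classes, the kernel integrand of the `markov`
clause agrees a.e. with the Borel function `gval`.** [folklore] -/
theorem indicator_sleMarkovKernel_ae_eq_gval (h0 : HasSLETrace κ)
    (htr' : ∀ᵐ ω ∂Process.preWienerMeasure, Tendsto (fun t ↦ ‖sleTrace κ ω t‖) atTop atTop) {F : Set ℂ} (hF : IsClosed F) (S : Set (CurveClass ℂ))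
    {T : Set (CurveClass ℂ)} (hT : MeasurableSet T) {μ : Measure (CurveClass ℂ)}
    (hμ : ∀ᵐ c ∂μ, IsLoewnerDescribable φ c) :
    (fun c ↦ (CurveClass.stopAt F ⁻¹' S).indicator
        (fun c ↦ sleMarkovKernel κ D (CurveClass.stopAt F c) T) c) =ᵐ[μ] gval κ φ F S T :=
  hμ.mono fun _ hc ↦ (gval_eq_of_isLoewnerDescribable hφ h0 htr' hF S hT hc).symm

include hφ in
/-- **Transport**: for a push-forward law `μ = P.map Γ` with a.e. describable `Γ ω`, the kernel
integral of the `markov` clause is the `P`-integral of `gval ∘ Γ`. [folklore] -/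
theorem lintegral_indicator_sleMarkovKernel_eq (h0 : HasSLETrace κ)
    (htr' : ∀ᵐ ω ∂Process.preWienerMeasure, Tendsto (fun t ↦ ‖sleTrace κ ω t‖) atTop atTop) {F : Set ℂ} (hF : IsClosed F) {S T : Set (CurveClass ℂ)}
    (hS : MeasurableSet S) (hT : MeasurableSet T) {Ω : Type*} [MeasurableSpace Ω] {P : Measure Ω}
    {Γ : Ω → CurveClass ℂ} (hΓ : AEMeasurable Γ P) (hdesc : ∀ᵐ ω ∂P, IsLoewnerDescribable φ (Γ ω)) :
    ∫⁻ c, (CurveClass.stopAt F ⁻¹' S).indicator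
        (fun c ↦ sleMarkovKernel κ D (CurveClass.stopAt F c) T) c ∂(P.map Γ) =
      ∫⁻ ω, gval κ φ F S T (Γ ω) ∂P := by
  have hμ : ∀ᵐ c ∂(P.map Γ), IsLoewnerDescribable φ c :=
    (ae_map_iff hΓ (measurableSet_setOf_isLoewnerDescribable hφ)).2 hdesc
  rw [lintegral_congr_ae (indicator_sleMarkovKernel_ae_eq_gval hφ h0 htr' hF S hT hμ),
    lintegral_map' (measurable_gval hφ h0 hF hS hT).aemeasurable hΓ]

/-! #### Locality of `psiTilde` in the driver and a node-value congruence -/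

/-- `compactifiedClass` only depends on the node values: if `Φ (w t) = Φ' (w' t)` for all `t`,
the two compactified classes (same endpoint) agree. [folklore] -/
theorem compactifiedClass_congr₂ {Φ Φ' : ℂ → ℂ} {b : ℂ} {w w' : ℝ≥0 → ℂ}
    (h : ∀ t, Φ (w t) = Φ' (w' t)) : compactifiedClass Φ b w = compactifiedClass Φ' b w' := by
  have hnode : nodeValue Φ b w = nodeValue Φ' b w' := by
    funext s
    unfold nodeValue
    split_ifs
    · exact h _
    · rfl
  unfold compactifiedClass compactifiedLimit
  have happ : compactifiedApprox Φ b w = compactifiedApprox Φ' b w' := by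
    funext n
    unfold compactifiedApprox
    rw [hnode]
  rw [happ]

/-- **The inverse Loewner map at time `r` only depends on the driver up to time `r`.**
[cite: Lawler2005, Ch. 4 §4.1] -/
theorem Loewner.loewnerInv_eq_of_eqOn {W U : ℝ≥0 → ℝ} (hW : Continuous W) (hU : Continuous U)
    {r : ℝ≥0} (heq : ∀ s, s ≤ r → W s = U s) {z : ℂ} (hz : z ∈ upperHalfPlaneSet) :
    Loewner.loewnerInv U r z = Loewner.loewnerInv W r z := by
  set w := Loewner.loewnerInv W r z with hw
  have hwd : w ∈ Loewner.domain W r := Loewner.loewnerInv_mem_domain hW r hz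
  have hmap : Loewner.map W r w = z := Loewner.map_loewnerInv hW r hz
  have hlt : ((r : ℝ≥0) : WithTop ℝ≥0) < Loewner.swallowingTime W w := ((Loewner.mem_domain_iff W r w).1 hwd).2
  have hltU : ((r : ℝ≥0) : WithTop ℝ≥0) < Loewner.swallowingTime U w :=
    Loewner.coe_lt_swallowingTime_of_eqOn hW hU heq hlt
  have hwdU : w ∈ Loewner.domain U r := (Loewner.mem_domain_iff U r w).2 ⟨hwd.1, hltU⟩
  have hmapU : Loewner.map U r w = z := by rw [Loewner.map_eq_of_eqOn hW hU heq hlt le_rfl, hmap]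
  rw [← hmapU, Loewner.loewnerInv_map hU hwdU]

/-- **`psiTilde` only depends on the driver up to time `r`.** [folklore] -/
theorem psiTilde_eq_of_eqOn {Φ : ℂ → ℂ} {W U : C(ℝ≥0, ℝ)} {r : ℝ≥0}
    (heq : ∀ s, s ≤ r → W s = U s) (w : ℂ) : psiTilde Φ U r w = psiTilde Φ W r w := by
  unfold psiTilde
  have hpt : ∀ n : ℕ, Loewner.liftIm 0 w + (U r : ℂ) + Complex.I * (((1 : ℝ) / ((n : ℝ) + 1) : ℝ) : ℂ) ∈
      upperHalfPlaneSet := fun n ↦ by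
    change 0 < (Loewner.liftIm 0 w + (U r : ℂ) + Complex.I * (((1 : ℝ) / ((n : ℝ) + 1) : ℝ) : ℂ)).im
    simp only [add_im, ofReal_im, add_zero, mul_im, I_re, I_im, ofReal_re, zero_mul, one_mul, zero_add]
    have := Loewner.le_im_liftIm 0 w
    positivity
  congr 1
  funext n
  rw [heq r le_rfl, Loewner.loewnerInv_eq_of_eqOn W.continuous U.continuous heq (hpt n)]

end Transport

end Literature.Probability.RandomPlanarGeometry

end
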